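import Literature.AnabelianGeometry.EtaleTheta.KummerMap
import Summits.ABC.IUTFork.LanaKummer
import HarnessLib

/-!
# L-LANA objects XII ter: the Kummer map into `lim_{→ H open} H¹(H, Λ)` at a nonarchimedean place (LANA §6.1, §6.2 (g); N13 colimit REALISED)

Record-only file (D-0012) of the abc-iut cell (seat abc-iut-c312-4, L-LANA level, plan/LLANA-SPEC N13 "colimit
over `H`", N14 Step 6); TAKES NO SIDE on [IUTchIII] Cor. 3.12. LANA §6.1 p. 31: "Let `H` vary over an inductive
system of (open) subgroups of `G` (with respect to inclusion). … (c) one has `M = ⋃_H M^H` … Taking colimits in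
`H`, we obtain `κ : M → lim_{→ H} H¹(H, Λ(M))`. This map is `G`-equivariant with respect to the natural action of
`G` on `H¹`. We refer to all such maps as *Kummer maps*." and §6.2 (g) p. 35: "`κ_t : O^▷_{v,t} →
∞H¹(D_t, Λ_{v,t})` is the local Kummer map". Seat abc-iut-L2-t3 PROVED the general construction
(`KummerMap.lean`: `kummerMapHom` over a directed antitone system `S`, under hypothesis (c) `IsExhausted`).
`LanaKummer.lean` (gen 0) instantiated only the fixed levels `κ_H`. THIS FILE instantiates the colimit at the
CONSTRUCTED place datum `K̄_v = AlgCl K_v`, `G_v = Gal(K̄_v/K_v)` (Krull topology):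

* `AlgCl.Level K_v` — the inductive system: the OPEN NORMAL subgroups `H ⊴ G_v` ordered by reverse inclusion
  (a cofinal system of open subgroups; normality is what lets "the natural action of `G` on `H¹`" act on the
  system — the equivariance itself is the sibling file `LanaKummerTowerEquivariance.lean`, over L2-t3's
  `KummerEquivariance.lean`), directed (`H ∩ H'`), with `G_v` itself as the level `Level.top`;
* `AlgCl.isExhausted_units` — **hypothesis (c) "`M = ⋃_H M^H`" PROVED** for `M = K̄_v^×`: every `a ∈ K̄_v` is
  fixed by the open normal subgroup `Gal(K̄_v/E)`, `E ⊇ K_v(a)` finite normal (Mathlib: Krull-open stabilisers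
  `stabilizer_isOpen_of_isIntegral`, `krullTopology_mem_nhds_one_iff_of_normal`, and
  `InfiniteGalois.normal_iff_isGalois`; characteristic `0`);
* `AlgCl.H1Tower K_v` = `∞H¹ := lim_{→ H} H¹(H, Λ(K̄_v^×))`, `AlgCl.kummerTower` = **`κ : K̄_v^× → ∞H¹`** (a
  homomorphism), computing at every level as gen-0's `kummerAt H` (`kummerTower_apply_of_mem`) and on
  `K_v^× = (K̄_v^×)^{G_v}` as `kummerBase` (`kummerTower_apply_top`);
* `AlgCl.kummerTowerInt` — the restriction to `O^▷_{K̄_v} ⊆ K̄_v^×` ("`κ_t : O^▷_{v,t} → ∞H¹(D_t, Λ_{v,t})`",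
  §6.2 (g), with `D_t` acting through `G_v`; the object the slot `EtaSteps.kappa` of `LanaEtaAlgorithm.lean`
  stands for at a place), compatible with the `G_v`-actions on `O^▷` and `K̄_v^×` (`intMonoidToUnits_smul`).

Modelling notes. (i) Coefficients `Λ(K̄_v^×)` (= `Λ(O^×_v)`, the torsion of `K̄_v^×` being `μ`), as in
`LanaKummer.lean`. (ii) `Π_v`-inflation (`H¹(G_v,–) → H¹(Π_v,–)`) and the continuous comparison are L2's
`KummerContH1.lean`; not repeated. (iii) Injectivity of `κ` on `K_v^×` is `LanaKummerInjective.lean`; injectivity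
on all of `K̄_v^×` needs "`⋂_n (E^×)^n = 1` for every finite `E/K_v`" (L4 `MLFClosure.eq_one_of_forall_pos_exists_pow_eq`,
other presentation) plus exactness of the direct limit, not asserted here.
[cite: LANA2026Report, §6.1 p. 31, §6.2 (g) p. 35, §4.2 (b) p. 26] NOT here: any judgement.
-/
noncomputable section

namespace Summit.ABC
namespace IUTFork
namespace AlgCl

open Literature.AnabelianGeometry.EtaleTheta
open scoped NNReal Topology

/-! ## 1. The inductive system of open normal subgroups of `G_v` -/

section Levels

variable (K₀ : Type) [NontriviallyNormedField K₀]

/-- **The inductive system of §6.1**: the open normal subgroups `H ⊴ G_v = Gal(K̄_v/K_v)` (Krull topology) —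
"`H` var[ies] over an inductive system of (open) subgroups of `G` (with respect to inclusion)".
[cite: LANA2026Report, §6.1 p. 31] -/
def Level : Type := {U : OpenSubgroup (Gal K₀) // (U : Subgroup (Gal K₀)).Normal}

namespace Level

variable {K₀}

/-- The subgroup `H ≤ G_v` of a level. [cite: LANA2026Report, §6.1 p. 31] -/
def toSubgroup (i : Level K₀) : Subgroup (Gal K₀) := (i.1 : Subgroup (Gal K₀))

/-- Each level is a normal subgroup. [cite: LANA2026Report, §6.1 p. 31] -/
instance normal (i : Level K₀) : i.toSubgroup.Normal := i.2

/-- Each level is open in the Krull topology. [cite: LANA2026Report, §6.1 p. 31] -/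
theorem isOpen (i : Level K₀) : IsOpen (i.toSubgroup : Set (Gal K₀)) := i.1.isOpen

/-- The order of the inductive system: `H ≤ H'` iff `H' ⊆ H` (so that `H ↦ H¹(H, –)`, with restriction maps,
is a functor on it). [cite: LANA2026Report, §6.1 p. 31] -/
instance instPreorder : Preorder (Level K₀) where
  le i j := j.toSubgroup ≤ i.toSubgroup
  le_refl _ := le_rfl
  le_trans _ _ _ hij hjk := hjk.trans hij

/-- `H ≤ H'` in the system iff `H' ⊆ H`. [cite: LANA2026Report, §6.1 p. 31] -/
theorem le_def (i j : Level K₀) : i ≤ j ↔ j.toSubgroup ≤ i.toSubgroup := Iff.rfl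

/-- Equality of levels is decided classically (needed by Mathlib's direct limit). [folklore] -/
instance instDecidableEq : DecidableEq (Level K₀) := Classical.decEq _

/-- The meet `H ∩ H'` of two levels (open and normal). [folklore] -/
def inf (i j : Level K₀) : Level K₀ :=
  ⟨i.1 ⊓ j.1, by
    change ((i.1 : Subgroup (Gal K₀)) ⊓ (j.1 : Subgroup (Gal K₀))).Normal
    haveI := i.2; haveI := j.2
    infer_instance⟩

/-- `(H ∩ H').toSubgroup = H ⊓ H'`. [folklore] -/
theorem toSubgroup_inf (i j : Level K₀) : (inf i j).toSubgroup = i.toSubgroup ⊓ j.toSubgroup := rfl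

/-- The system is DIRECTED: `H, H' ≤ H ∩ H'`. [cite: LANA2026Report, §6.1 p. 31] -/
instance instIsDirectedOrder : IsDirectedOrder (Level K₀) :=
  ⟨fun i j => ⟨inf i j, by rw [le_def, toSubgroup_inf]; exact inf_le_left,
    by rw [le_def, toSubgroup_inf]; exact inf_le_right⟩⟩

/-- The level `G_v` itself (open and normal). [cite: LANA2026Report, §6.1 p. 31] -/
def top : Level K₀ := ⟨⊤, by change (⊤ : Subgroup (Gal K₀)).Normal; infer_instance⟩

/-- `top.toSubgroup = G_v`. [folklore] -/
@[simp] theorem toSubgroup_top : (top : Level K₀).toSubgroup = ⊤ := rfl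

/-- `G_v` is the least element of the system (every level lies above it). [folklore] -/
theorem top_le (i : Level K₀) : top ≤ i := by
  rw [le_def, toSubgroup_top]; exact le_top

end Level

/-- The system `H ↦ H` as a family of subgroups of `G_v` (the `S` of L2-t3's `KummerMap.lean`).
[cite: LANA2026Report, §6.1 p. 31] -/
def levelSubgroup : Level K₀ → Subgroup (Gal K₀) := fun i => i.toSubgroup

/-- The family is antitone for the system order (`H ≤ H' ⟹ H' ⊆ H`). [cite: LANA2026Report, §6.1 p. 31] -/
theorem levelSubgroup_anti : ∀ ⦃i j : Level K₀⦄, i ≤ j → levelSubgroup K₀ j ≤ levelSubgroup K₀ i :=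
  fun _ _ h => h

/-- Every member of the family is normal in `G_v`. [cite: LANA2026Report, §6.1 p. 31] -/
instance levelSubgroup_normal (i : Level K₀) : (levelSubgroup K₀ i).Normal := i.2

/-- `levelSubgroup top = G_v`. [folklore] -/
@[simp] theorem levelSubgroup_top : levelSubgroup K₀ Level.top = ⊤ := rfl

/-! ## 2. `∞H¹ := lim_{→ H} H¹(H, Λ(K̄_v^×))` and hypothesis (c) -/

/-- **`∞H¹(G_v, Λ) := lim_{→ H open normal} H¹(H, Λ(K̄_v^×))`** — L2-t3's `H1Colimit` (Mathlib
`AddCommGroup.DirectLimit` of the `H¹`'s along restriction) for the system of open normal subgroups of `G_v`.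
[cite: LANA2026Report, §6.1 p. 31, p. 32 "`∞H^i(G, A) := lim_J H^i(G|_J, A)`"] -/
abbrev H1Tower : Type := H1Colimit (AlgCl K₀)ˣ (levelSubgroup K₀) (levelSubgroup_anti K₀)

/-- The structure map `H¹(H, Λ) → ∞H¹`. [cite: LANA2026Report, §6.1 p. 31] -/
abbrev toTower (i : Level K₀) :
    groupCohomology.H1 (cyclotomeRep (A := (AlgCl K₀)ˣ) (levelSubgroup K₀ i)) →+ H1Tower K₀ :=
  toColimit (A := (AlgCl K₀)ˣ) (levelSubgroup K₀) (levelSubgroup_anti K₀) i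

variable [CharZero K₀]

/-- Every `a ∈ K̄_v` is fixed by some open NORMAL subgroup of `G_v`: the stabiliser of `a` is Krull-open, so
contains `Gal(K̄_v/E)` for a finite normal `E/K_v`, which is Galois in characteristic `0`, whence
`Gal(K̄_v/E) ⊴ G_v`. [cite: LANA2026Report, §6.1 (c) p. 31] -/
theorem exists_level_fixing (a : AlgCl K₀) : ∃ i : Level K₀, ∀ σ ∈ levelSubgroup K₀ i, σ • a = a := by
  have hs : (MulAction.stabilizer (Gal K₀) a : Set (Gal K₀)) ∈ 𝓝 (1 : Gal K₀) :=
    (stabilizer_isOpen_of_isIntegral (K := K₀) a).mem_nhds (Subgroup.one_mem _)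
  obtain ⟨E, hfd, hnorm, hsub⟩ := (krullTopology_mem_nhds_one_iff_of_normal K₀ (AlgCl K₀) _).mp hs
  haveI := hfd
  haveI := hnorm
  haveI : Algebra.IsSeparable K₀ E := Algebra.isSeparable_tower_bot_of_isSeparable K₀ E (AlgCl K₀)
  haveI : IsGalois K₀ E := {}
  refine ⟨⟨⟨E.fixingSubgroup, E.fixingSubgroup_isOpen⟩, ?_⟩, fun σ hσ => ?_⟩
  · change E.fixingSubgroup.Normal
    exact (InfiniteGalois.normal_iff_isGalois E).mpr inferInstance
  · have hσ' : σ ∈ (MulAction.stabilizer (Gal K₀) a : Set (Gal K₀)) := hsub hσ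
    exact hσ'

/-- **Hypothesis (c) of §6.1 PROVED for `M = K̄_v^×`**: "`M = ⋃_H M^H`, where `H` varies over the subgroups under
consideration" (L2-t3's `IsExhausted`). [cite: LANA2026Report, §6.1 (c) p. 31] -/
theorem isExhausted_units : IsExhausted (AlgCl K₀)ˣ (levelSubgroup K₀) := fun a => by
  obtain ⟨i, hi⟩ := exists_level_fixing K₀ (a : AlgCl K₀)
  refine ⟨i, fun σ => ?_⟩
  change ((σ : Gal K₀) • a : (AlgCl K₀)ˣ) = a
  exact Units.ext (by rw [units_coe_smul]; exact hi σ σ.2)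

/-! ## 3. The Kummer map `κ : K̄_v^× → ∞H¹` -/

/-- **`κ : K̄_v^× → lim_{→ H} H¹(H, Λ(K̄_v^×))`** ("Taking colimits in `H`, we obtain `κ : M → lim_{→ H}
H¹(H, Λ(M))`") — L2-t3's `kummerMapHom` over the CONSTRUCTED system, hypotheses (a) rootable
(`rootableUnits`, gen 0) and (c) (`isExhausted_units`) discharged. [cite: LANA2026Report, §6.1 p. 31] -/
def kummerTower : Additive (AlgCl K₀)ˣ →+ H1Tower K₀ :=
  kummerMapHom (levelSubgroup_anti K₀) (isExhausted_units K₀)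

/-- `κ` computes at any level fixing `a` as the level-`H` Kummer map `κ_H` of `LanaKummer.lean`:
`κ(a) = [κ_H(a)]`. [cite: LANA2026Report, §6.1 p. 31] -/
theorem kummerTower_apply_of_mem (i : Level K₀)
    (a : invariants (A := (AlgCl K₀)ˣ) (levelSubgroup K₀ i)) :
    kummerTower K₀ (Additive.ofMul (a : (AlgCl K₀)ˣ)) =
      toTower K₀ i (kummerAt K₀ (levelSubgroup K₀ i) (Additive.ofMul a)) :=
  kummerMapHom_apply_of_mem (levelSubgroup_anti K₀) (isExhausted_units K₀) i a

/-- On `K_v^× = (K̄_v^×)^{G_v}` (§4.2 (b)), `κ` is the image in `∞H¹` of gen-0's `kummerBase`: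
`κ(a) = [κ_{G_v}(a)]`. [cite: LANA2026Report, §4.2 (b) p. 26, §6.1 p. 31] -/
theorem kummerTower_apply_top (a : invariants (A := (AlgCl K₀)ˣ) (⊤ : Subgroup (Gal K₀))) :
    kummerTower K₀ (Additive.ofMul (a : (AlgCl K₀)ˣ)) =
      toTower K₀ Level.top (kummerBase K₀ (Additive.ofMul a)) :=
  kummerTower_apply_of_mem K₀ Level.top a

/-- `κ(ab) = κ(a) + κ(b)`. [cite: LANA2026Report, §6.1 p. 31] -/
theorem kummerTower_mul (a b : (AlgCl K₀)ˣ) :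
    kummerTower K₀ (Additive.ofMul (a * b)) =
      kummerTower K₀ (Additive.ofMul a) + kummerTower K₀ (Additive.ofMul b) :=
  map_add (kummerTower K₀) (Additive.ofMul a) (Additive.ofMul b)

end Levels

/-! ## 4. The local Kummer map on `O^▷_{K̄_v}` (§6.2 (g): "`κ_t : O^▷_{v,t} → ∞H¹(D_t, Λ_{v,t})`") -/

section IntMonoid

variable (K₀ : Type) [NontriviallyNormedField K₀] [CompleteSpace K₀] [IsUltrametricDist K₀]

/-- `O^▷_{K̄_v} → K̄_v^×`: an element of `O^▷ = {0 < |a| ≤ 1}` is a unit of the field.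
[cite: LANA2026Report, §0.4 (b) p. 8] -/
def intMonoidToUnits : intMonoid (val K₀) →* (AlgCl K₀)ˣ where
  toFun a := Units.mk0 (a : AlgCl K₀) ((Valuation.pos_iff (val K₀)).mp a.2.1)
  map_one' := Units.ext rfl
  map_mul' _ _ := Units.ext rfl

/-- Underlying element. [cite: LANA2026Report, §0.4 (b) p. 8] -/
@[simp] theorem coe_intMonoidToUnits (a : intMonoid (val K₀)) :
    ((intMonoidToUnits K₀ a : (AlgCl K₀)ˣ) : AlgCl K₀) = a := rfl

/-- `O^▷ → K̄_v^×` is injective. [folklore] -/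
theorem intMonoidToUnits_injective : Function.Injective (intMonoidToUnits K₀) := fun a b h =>
  Subtype.ext (by rw [← coe_intMonoidToUnits K₀ a, ← coe_intMonoidToUnits K₀ b, h])

/-- `O^▷ → K̄_v^×` is `G_v`-equivariant (both actions are the field action). [cite: LANA2026Report, §3.7 p. 20] -/
theorem intMonoidToUnits_smul (σ : Gal K₀) (a : intMonoid (val K₀)) :
    intMonoidToUnits K₀ (σ • a) = σ • intMonoidToUnits K₀ a :=
  Units.ext rfl

variable [CharZero K₀]

/-- **`κ : O^▷_{K̄_v} → ∞H¹(G_v, Λ)`** — the local Kummer map of §6.2 (g) ("`κ_t : O^▷_{v,t} → ∞H¹(D_t, Λ_{v,t})`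
is the local Kummer map", the decomposition group `D_t` acting through `G_v`): the restriction of `κ` along
`O^▷ ⊆ K̄_v^×` (§6.1: "`M^H → (M^{gp})^H → H¹(H, Λ(M))`"). This is the object the slot `EtaSteps.kappa t` of
`LanaEtaAlgorithm.lean` stands for at a place. [cite: LANA2026Report, §6.2 (g) p. 35, §6.1 p. 31] -/
def kummerTowerInt : intMonoid (val K₀) →* Multiplicative (H1Tower K₀) :=
  (AddMonoidHom.toMultiplicativeRight (kummerTower K₀)).comp (intMonoidToUnits K₀)

/-- `κ` on `O^▷` is `κ` on `K̄_v^×` restricted. [cite: LANA2026Report, §6.1 p. 31] -/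
theorem toAdd_kummerTowerInt (a : intMonoid (val K₀)) :
    (kummerTowerInt K₀ a).toAdd = kummerTower K₀ (Additive.ofMul (intMonoidToUnits K₀ a)) := rfl

end IntMonoid

end AlgCl

end IUTFork

end Summit.ABC

end
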